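import Literature.MathematicalPhysics.QuantumFieldTheory.Balaban1983to89.B9Eq315QTower

/-!
# `Balaban1983to89.B9Eq315ProfileTower` — T. Bałaban, *Averaging operations for lattice gauge theories*, Commun. Math. Phys. **98** (1985) 17–51
# [Balaban1985Averaging] (42)–(43) pp. 23–24, Prop. 2 (52)–(53) p. 26, read on the tower of tori of *Propagators for lattice gauge theories in a
# background field*, Commun. Math. Phys. **99** (1985) 389–434 [Balaban1985BackgroundPropagators] (3.15) p. 393: **THE BOND-WINDOW PROFILE OF THE
# COMPUTED AVERAGED TOWER `Ū^j = UlevOf L m (n+1) U j`** — from the fine bond window `‖U(b) − 1‖ ≤ αη` and plaquette smallness (52) at `η = (L^{n+1})⁻¹`,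
# every level is `G`-valued and `‖Ū^{n−j}(b) − 1‖ ≤ ((α + 2D∕L)∕L)·(1∕L)^j`, `D = 128(d+1)(d+4)α₀`

proved theorems over the tree's [B7] ∕ [B9] objects (`B7Prop1Explicit`, `B7Prop2Explicit`, `B9Eq315QTower`); no `Prop` placeholder; nothing here is a
claim about the Yang–Mills mass gap

THE PRINT.  [Balaban1985Averaging] (42)–(43) pp. 23–24 define the block average `Ū(c) = exp(X̄_c)·U(c)`, `X̄_c = Σ_x L^{−d} log(U(Γ_{c,x})U(c)⁻¹)`, and its
iterates `Ū^j`; Prop. 2 (52)–(53) p. 26 bounds the plaquette variables of every `Ū^j` from the fine smallness `sup_p |U(∂p) − 1| < α₀η²`.  The `k`-th step of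
[Balaban1985BackgroundPropagators] works with the whole averaged tower ((3.15) p. 393, the backgrounds of the factors of `Q_k(U)`), typed in the tree as
`B9Eq315QTower.UlevOf`; the `k`-level propagator theorems of the tree (`B9Thm311SitePrimeFormCoerciveTowerCanonical.exists_strong_site_coercive_tower_diagonal`
and its companions) take as HYPOTHESES a bond window on every level, `‖Ū^j(b) − 1‖ ≤ ε_j ≤ α r^j`, all levels in `U1`.  This file DERIVES those hypotheses
for the computed tower from the fine window and (52): a printed consequence of (42)–(43) + Prop. 2 that the print uses tacitly («the averaged
configurations satisfy the same regularity conditions»), made explicit with constants.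

WHAT IS PROVED (sorry-free).
* PART A (`namespace … .BondWindow`) — the ONE-STEP BOND RECURSION of (42)–(43) on `ℤ^d`: `‖V(seg) − 1‖ ≤ n·ε` (`norm_hol_seg_sub_one_le`); the curvature
  exponent `‖X̄_c‖ ≤ 32(d+1)(d+4)L²α₀` under (44) (`norm_Xavg_le`, from the tree's `norm_Wcx_sub_one_le` + `norm_mlog_le_two_mul`); hence
  `‖Ū(b) − 1‖ ≤ L·ε + 64(d+1)(d+4)L²α₀` (`norm_bavg_sub_one_le`, `norm_avgIter_succ_sub_one_le`); the level induction `bond_window_tower`; and its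
  instantiation under EXACTLY the hypotheses of the tree's `B7Prop2Explicit.prop2_explicit` ∕ `ineq53_explicit` ∕ `avgIter_mem` + the fine window:
  **`bond_window_tower_of_prop2`** — `‖Ū^j(b) − 1‖ ≤ b j` for `j ≤ k+1`, `b 0 = ε`, `b (i+1) = L·b i + 128(d+1)(d+4)α₀(L^{i+1}η)²`.
* PART B (`namespace … .Profile`) — the ARITHMETIC of the recursion `ε_{i+1} ≤ L·ε_i + D(L^{i+1}η)²`, `ε_0 ≤ αη`, `L ≥ 2`: invariant
  `ε_i ≤ α(L^iη) + 2D(L^iη)²` (`profile_invariant`), on the diagonal `ηL^{n+1} = 1` the linear profile `ε_i ≤ (α + 2D∕L)·L^iη` (`profile_diagonal`) and,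
  in the coarsest-first indexing, the GEOMETRIC profile `ε_{n−j} ≤ ((α + 2D∕L)∕L)·(1∕L)^j` (`profile_geometric`); `ratio_admissible`.
* PART C (file namespace) — **`profile_UlevOf`**: for `U` on the level-`(n+1)` torus `T_{L^{n+1}m}` with values in an `AvgClosed` group `G`, window
  `‖U b − 1‖ ≤ α(L^{n+1})⁻¹` and (52) for its periodic extension (`C₀α₀ ≤ 1/3`, `2α₀ ≤ c₂′`, `L ≥ 2`): every level `UlevOf L m (n+1) U j`, `j ≤ n`, is
  `G`-valued and within `((α + 2D∕L)∕L)·(1∕L)^j` of `1`; **`profile_UlevOf_supplier`**: given moreover `0 ≤ α` and `256(d+1)(d+4)α₀ ≤ L(L−1)α`, LITERALLY the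
  four profile binders `(∀ j, 0 ≤ εU j)`, `(∀ j < n+1, εU j ≤ α(1∕L)^j)`, `(∀ j b, ‖UlevOf … j b − 1‖ ≤ εU j)`, `(∀ j b, UlevOf … j b ∈ U1)` of
  `exists_strong_site_coercive_tower_diagonal` with `r = 1∕L` (junk levels `j > n` included: there `UlevOf … j` reads `U` itself).
DESIGN.  `UlevOf L m (n+1) U j b = avgIter L (perCfg U) (n − j) (liftSite b.1) b.2` by definition (`B9Eq315QTower` §3), so PART C is PART A at
`V := perCfg U` composed with PART B for the bound sequence `bseq`.  PARTS A and B sit in their own sub-namespaces; the pure-arithmetic lemmas (PART B,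
`bound53_le_two_mul`, the `bseq` simp lemmas, one normed-ring inequality) are `private` `[folklore]` helpers — the exported, cited content is PART A's
bond recursion ∕ tower and PART C.
PROVENANCE.  Ideation cell ym-nodeO-ideate (lens P1), companion 21 edition 1 of memo ROUTE-P1 §0y.16–§0y.18 (sha256 99a84e4e7c82dccb…, referee-endorsed
for landing 2026-08-27); this file is that edition with the path namespace, qualified `B7Prop1Explicit.Site`, selective opens, provenance tags and
`private` on the eleven arithmetic helpers — statements and proof scripts otherwise verbatim.
HONEST SCOPE.  Elementary estimates + bookkeeping; NOT a propagator theorem, NOT [Balaban1985BackgroundPropagators] Thm 3.11, NOT summit progress; the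
smallness thresholds are the tree's (`C0 d`, `c2' d L` of `B7Prop2Explicit`), not optimised.  What is deliberately NOT here: the construction of print's
localised background `Ũ_□`, any call of the `k`-level suppliers, anything about the renormalization-group step.  Net new unproved facts: 0.
-/

namespace Literature.MathematicalPhysics.QuantumFieldTheory.Balaban1983to89.B9Eq315ProfileTower

open NormedSpace Finset
open B7Prop1Explicit B7Prop2Explicit MatrixLog

/-! # PART A — the one-step bond recursion (42)–(43) and the bond-window tower under (52), on `ℤ^d` -/

namespace BondWindow

variable {d : ℕ} {𝔸 : Type*} [NormedRing 𝔸] [NormOneClass 𝔸] [NormedAlgebra ℂ 𝔸] [CompleteSpace 𝔸]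

/-! ## §1 Straight segments: `‖V(seg) − 1‖ ≤ n·ε` -/

omit [NormOneClass 𝔸] [NormedAlgebra ℂ 𝔸] [CompleteSpace 𝔸] in
/-- `‖a·b − 1‖ ≤ ‖a − 1‖ + ‖b − 1‖` when the RIGHT factor has norm `≤ 1` (`ab − 1 = (a − 1)b + (b − 1)`). [folklore] -/
private theorem norm_mul_sub_one_le_of_norm_le_one_right {a b : 𝔸} (hb : ‖b‖ ≤ 1) :
    ‖a * b - 1‖ ≤ ‖a - 1‖ + ‖b - 1‖ := by
  have h : a * b - 1 = (a - 1) * b + (b - 1) := by noncomm_ring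
  rw [h]
  calc ‖(a - 1) * b + (b - 1)‖ ≤ ‖(a - 1) * b‖ + ‖b - 1‖ := norm_add_le _ _
    _ ≤ ‖a - 1‖ * ‖b‖ + ‖b - 1‖ := by gcongr; exact norm_mul_le _ _
    _ ≤ ‖a - 1‖ * 1 + ‖b - 1‖ := by gcongr
    _ = ‖a - 1‖ + ‖b - 1‖ := by ring

omit [NormedAlgebra ℂ 𝔸] [CompleteSpace 𝔸] in
/-- (L1a) Parallel transport along the straight segment of `n` bonds in direction `κ` deviates from `1` by at most
`n·ε` if every bond variable lies in `U1` and within `ε` of `1`. [cite: Balaban1985Averaging, (42)–(43) pp.23–24] -/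
theorem norm_hol_seg_sub_one_le {V : B7Prop1Explicit.Site d → Fin d → 𝔸ˣ} (hV : ∀ x κ, V x κ ∈ U1 𝔸) {ε : ℝ}
    (hε : ∀ x κ, ‖((V x κ : 𝔸ˣ) : 𝔸) - 1‖ ≤ ε) (z : B7Prop1Explicit.Site d) (κ : Fin d) :
    ∀ n : ℕ, ‖((hol V z (seg κ (n : ℤ)) : 𝔸ˣ) : 𝔸) - 1‖ ≤ n * ε
  | 0 => by simp
  | n + 1 => by
    rw [Nat.cast_succ, hol_seg_natCast_succ, Units.val_mul, Nat.cast_succ, add_mul, one_mul]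
    exact (B8Ineq170.norm_mul_sub_one_le_of_norm_le_one (hol_mem hV _ _).1).trans
      (add_le_add (norm_hol_seg_sub_one_le hV hε z κ n) (hε _ _))

/-! ## §2 The curvature term: `‖X̄_c‖ ≤ 4θ`, `θ = 8(d+1)(d+4)L²α₀` -/

/-- (L2) The exponent of the block average (42), `X̄_c = Σ_x L^{−d} log(V(Γ_{c,x})V(c)⁻¹)`, has norm at most
`4θ = 32(d+1)(d+4)L²α₀` under the plaquette bound (44) `|V(∂p) − 1| ≤ α₀` and the tree's smallness condition:
each loop variable is within `2θ ≤ 1/2` of `1` (`B7Prop2Explicit.norm_Wcx_sub_one_le`), so its logarithm has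
norm `≤ 4θ` (`MatrixLog.norm_mlog_le_two_mul`), and `X̄_c` is an average of `L^d` such logarithms. [cite: Balaban1985Averaging, (42)–(44) pp.23–24] -/
theorem norm_Xavg_le (L : ℕ) (hL : 1 ≤ L) (V : B7Prop1Explicit.Site d → Fin d → 𝔸ˣ) (hV : ∀ x κ, V x κ ∈ U1 𝔸)
    {α₀ : ℝ} (hα₀ : 0 ≤ α₀) (hsmall : 512 * (d + 1) * (d + 4) * (L : ℝ) ^ 2 * α₀ ≤ 1)
    (h44 : ∀ (x : B7Prop1Explicit.Site d) (κ κ' : Fin d), κ ≠ κ' → ‖((hol V x (plaqWord κ κ') : 𝔸ˣ) : 𝔸) - 1‖ ≤ α₀)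
    (q : B7Prop1Explicit.Site d) (κ : Fin d) :
    ‖Xavg L V q κ‖ ≤ 4 * (8 * (d + 1) * (d + 4) * (L : ℝ) ^ 2 * α₀) := by
  set θ : ℝ := 8 * (d + 1) * (d + 4) * (L : ℝ) ^ 2 * α₀ with hθ
  have hθ0 : 0 ≤ θ := by positivity
  have hθ1 : θ ≤ 1 / 64 := by rw [hθ]; nlinarith
  have hmlog : ∀ r : Fin d → Fin L, ‖mlog (((Wcx L V q κ (boxVec L r) : 𝔸ˣ) : 𝔸))‖ ≤ 4 * θ := by
    intro r
    have hW := norm_Wcx_sub_one_le L hL V hV hα₀ hsmall h44 q κ r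
    have hhalf : ‖((Wcx L V q κ (boxVec L r) : 𝔸ˣ) : 𝔸) - 1‖ ≤ 1 / 2 := hW.trans (by linarith)
    exact (norm_mlog_le_two_mul hhalf).trans (by linarith)
  have hLd : ((L : ℝ) ^ d)⁻¹ * (L : ℝ) ^ d = 1 :=
    inv_mul_cancel₀ (pow_ne_zero _ (by exact_mod_cast (by omega : L ≠ 0)))
  calc ‖Xavg L V q κ‖
      ≤ ∑ r : Fin d → Fin L, ‖(((L : ℝ) ^ d)⁻¹) • mlog (((Wcx L V q κ (boxVec L r) : 𝔸ˣ) : 𝔸))‖ :=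
        norm_sum_le _ _
    _ ≤ ∑ _r : Fin d → Fin L, ((L : ℝ) ^ d)⁻¹ * (4 * θ) := by
        refine sum_le_sum fun r _ => ?_
        rw [norm_smul, norm_inv, norm_pow, Real.norm_natCast]
        exact mul_le_mul_of_nonneg_left (hmlog r) (by positivity)
    _ = 4 * θ := by
        rw [sum_const, card_univ, Fintype.card_fun, Fintype.card_fin, Fintype.card_fin, nsmul_eq_mul,
          Nat.cast_pow, ← mul_assoc, mul_comm ((L : ℝ) ^ d), hLd, one_mul]

/-! ## §3 The one-step bond recursion (42)–(43) -/

/-- (L1)+(L2) AT ONE BOND of the `L`-lattice: `V̄_c = e^{X̄_c}·V(seg)` deviates from `1` by at most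
`L·ε + 8θ`, `8θ = 64(d+1)(d+4)L²α₀` — the straight segment contributes `L·ε` (§1) and the curvature factor
`‖e^{X̄_c} − 1‖ ≤ e^{4θ} − 1 ≤ 8θ` (§2 with the tree's `exp4_sub_one_le`). [cite: Balaban1985Averaging, (42)–(43) pp.23–24] -/
theorem norm_bavg_sub_one_le (L : ℕ) (hL : 1 ≤ L) (V : B7Prop1Explicit.Site d → Fin d → 𝔸ˣ) (hV : ∀ x κ, V x κ ∈ U1 𝔸)
    {ε α₀ : ℝ} (hε : ∀ x κ, ‖((V x κ : 𝔸ˣ) : 𝔸) - 1‖ ≤ ε)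
    (hα₀ : 0 ≤ α₀) (hsmall : 512 * (d + 1) * (d + 4) * (L : ℝ) ^ 2 * α₀ ≤ 1)
    (h44 : ∀ (x : B7Prop1Explicit.Site d) (κ κ' : Fin d), κ ≠ κ' → ‖((hol V x (plaqWord κ κ') : 𝔸ˣ) : 𝔸) - 1‖ ≤ α₀)
    (q : B7Prop1Explicit.Site d) (κ : Fin d) :
    ‖((bavg L V q κ : 𝔸ˣ) : 𝔸) - 1‖ ≤ L * ε + 64 * (d + 1) * (d + 4) * (L : ℝ) ^ 2 * α₀ := by
  set θ : ℝ := 8 * (d + 1) * (d + 4) * (L : ℝ) ^ 2 * α₀ with hθ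
  have hθ0 : 0 ≤ θ := by positivity
  have hθ1 : θ ≤ 1 / 64 := by rw [hθ]; nlinarith
  have hX : ‖Xavg L V q κ‖ ≤ 4 * θ := norm_Xavg_le L hL V hV hα₀ hsmall h44 q κ
  have hexp : ‖exp (Xavg L V q κ) - 1‖ ≤ 8 * θ :=
    (norm_exp_sub_one_le_of_norm_le hX).1.trans (exp4_sub_one_le hθ0 hθ1)
  have hseg : ‖((hol V q (seg κ (L : ℤ)) : 𝔸ˣ) : 𝔸) - 1‖ ≤ L * ε := norm_hol_seg_sub_one_le hV hε q κ L
  have hseg1 : ‖((hol V q (seg κ (L : ℤ)) : 𝔸ˣ) : 𝔸)‖ ≤ 1 := (hol_mem hV _ _).1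
  show ‖exp (Xavg L V q κ) * ((hol V q (seg κ (L : ℤ)) : 𝔸ˣ) : 𝔸) - 1‖ ≤ _
  calc _ ≤ ‖exp (Xavg L V q κ) - 1‖ + ‖((hol V q (seg κ (L : ℤ)) : 𝔸ˣ) : 𝔸) - 1‖ :=
        norm_mul_sub_one_le_of_norm_le_one_right hseg1
    _ ≤ 8 * θ + L * ε := add_le_add hexp hseg
    _ = L * ε + 64 * (d + 1) * (d + 4) * (L : ℝ) ^ 2 * α₀ := by rw [hθ]; ring

/-- The same bound for the NEXT LEVEL of the iterated average (43), `Ū^{j+1} = rescale L (bavg L Ū^j)`: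
the rescaling only relabels sites. [cite: Balaban1985Averaging, (42)–(43) pp.23–24] -/
theorem norm_avgIter_succ_sub_one_le (L : ℕ) (hL : 1 ≤ L) (V : B7Prop1Explicit.Site d → Fin d → 𝔸ˣ) (j : ℕ)
    (hV : ∀ x κ, avgIter L V j x κ ∈ U1 𝔸) {ε α₀ : ℝ}
    (hε : ∀ x κ, ‖((avgIter L V j x κ : 𝔸ˣ) : 𝔸) - 1‖ ≤ ε)
    (hα₀ : 0 ≤ α₀) (hsmall : 512 * (d + 1) * (d + 4) * (L : ℝ) ^ 2 * α₀ ≤ 1)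
    (h44 : ∀ (x : B7Prop1Explicit.Site d) (κ κ' : Fin d), κ ≠ κ' →
      ‖((hol (avgIter L V j) x (plaqWord κ κ') : 𝔸ˣ) : 𝔸) - 1‖ ≤ α₀)
    (z : B7Prop1Explicit.Site d) (κ : Fin d) :
    ‖((avgIter L V (j + 1) z κ : 𝔸ˣ) : 𝔸) - 1‖ ≤ L * ε + 64 * (d + 1) * (d + 4) * (L : ℝ) ^ 2 * α₀ := by
  rw [avgIter_succ]
  exact norm_bavg_sub_one_le L hL (avgIter L V j) hV hε hα₀ hsmall h44 ((L : ℤ) • z) κ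

/-! ## §4 The level induction: bond windows of the whole tower from per-level plaquette bounds -/

/-- THE BOND-WINDOW TOWER.  If every level `Ū^i`, `i ≤ n`, of the iterated average (43) is `U1`-valued and has
plaquette deviation `≤ a i` with `512(d+1)(d+4)L²·a i ≤ 1`, and the fine field has the bond window `ε`, then
`‖Ū^i(b) − 1‖ ≤ b i` for all `i ≤ n + 1`, where `b 0 = ε`, `b (i+1) = L·b i + 64(d+1)(d+4)L²·a i`.  (The `a i`
are what `B7Prop2Explicit.prop2_explicit` supplies — `a i ≍ (L^iη)²·pdev` — and companion 19 then yields the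
geometric profile `‖Ū^{n−j} − 1‖ ≤ α′(1/L)^j` on the scaling diagonal `ηL^{n+1} = 1`.) [cite: Balaban1985Averaging, (43) p.24, Prop. 2 (52)–(53) p.26] -/
theorem bond_window_tower (L : ℕ) (hL : 1 ≤ L) (V : B7Prop1Explicit.Site d → Fin d → 𝔸ˣ) (n : ℕ)
    (hmem : ∀ i ≤ n, ∀ x κ, avgIter L V i x κ ∈ U1 𝔸)
    (a : ℕ → ℝ) (ha : ∀ i ≤ n, 0 ≤ a i) (hsmall : ∀ i ≤ n, 512 * (d + 1) * (d + 4) * (L : ℝ) ^ 2 * a i ≤ 1)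
    (hplaq : ∀ i ≤ n, ∀ (x : B7Prop1Explicit.Site d) (κ κ' : Fin d), κ ≠ κ' →
      ‖((hol (avgIter L V i) x (plaqWord κ κ') : 𝔸ˣ) : 𝔸) - 1‖ ≤ a i)
    {ε : ℝ} (hε : ∀ x κ, ‖((V x κ : 𝔸ˣ) : 𝔸) - 1‖ ≤ ε)
    (b : ℕ → ℝ) (hb0 : b 0 = ε) (hb : ∀ i, b (i + 1) = L * b i + 64 * (d + 1) * (d + 4) * (L : ℝ) ^ 2 * a i) :
    ∀ i ≤ n + 1, ∀ (x : B7Prop1Explicit.Site d) (κ : Fin d), ‖((avgIter L V i x κ : 𝔸ˣ) : 𝔸) - 1‖ ≤ b i := by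
  intro i
  induction i with
  | zero => intro _ x κ; rw [hb0]; exact hε x κ
  | succ i ih =>
    intro hi x κ
    have hi' : i ≤ n := by omega
    rw [hb i]
    exact norm_avgIter_succ_sub_one_le L hL V i (hmem i hi') (ih (by omega)) (ha i hi') (hsmall i hi')
      (hplaq i hi') x κ

/-! ## §5 Instantiation from Proposition 2: the bond-window tower under (52) -/

/-- Arithmetic of (53) ⟹ the per-level plaquette bound is at most `2α₀(L^jη)²` (with `t = L^jη ≤ 1`, the bracket
`S ≤ 2` and `C₀α₀ ≤ 1/3`). [folklore] -/
private theorem bound53_le_two_mul {C₀ α₀ t S : ℝ} (hC : 0 ≤ C₀) (hα : 0 ≤ α₀) (hCα : C₀ * α₀ ≤ 1 / 3)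
    (ht0 : 0 ≤ t) (ht : t ≤ 1) (hS0 : 0 ≤ S) (hS : S ≤ 2) :
    α₀ * t ^ 2 + C₀ * (α₀ * t ^ 2) ^ 2 * S ≤ 2 * α₀ * t ^ 2 := by
  have ht2 : t ^ 2 ≤ 1 := pow_le_one₀ ht0 ht
  have hx0 : 0 ≤ α₀ * t ^ 2 := by positivity
  have hx : α₀ * t ^ 2 ≤ α₀ := mul_le_of_le_one_right hα ht2
  have h1 : (α₀ * t ^ 2) ^ 2 ≤ α₀ * (α₀ * t ^ 2) := by
    rw [sq]; exact mul_le_mul_of_nonneg_right hx hx0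
  have h2 : C₀ * (α₀ * t ^ 2) ^ 2 * S ≤ C₀ * (α₀ * (α₀ * t ^ 2)) * 2 :=
    mul_le_mul (mul_le_mul_of_nonneg_left h1 hC) hS hS0 (by positivity)
  have h3 : C₀ * (α₀ * (α₀ * t ^ 2)) * 2 = 2 * (C₀ * α₀) * (α₀ * t ^ 2) := by ring
  have h4 : 2 * (C₀ * α₀) * (α₀ * t ^ 2) ≤ 2 * (1 / 3) * (α₀ * t ^ 2) := by gcongr
  linarith

/-- THE BOND-WINDOW TOWER UNDER (52), from the tree's kernel-checked Proposition 2: for `L ≥ 2`, a configuration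
`U` on `ℤ^d` with values in an `AvgClosed` group `G` (e.g. unitaries, `B7Prop2Explicit.prop2_unitaryUnits`),
plaquette smallness (52) `sup_p |U(∂p) − 1| < α₀η²`, `η = L^{−k}`, `α₀ ≤ c₂` (as `C₀α₀ ≤ 1/3`, `2α₀ ≤ c₂′`), and
the fine BOND WINDOW `|U(b) − 1| ≤ ε`: every level `j ≤ k + 1` of the iterated average (43) satisfies
`|Ū^j(b) − 1| ≤ b j` for ANY real sequence `b` with `b 0 = ε` and
`b (i+1) = L·b i + 128(d+1)(d+4)α₀·(L^{i+1}η)²` — the per-level plaquette bounds come from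
`B7Prop2Explicit.ineq53_explicit` (majorised by `2α₀(L^iη)²`, `bound53_le_two_mul`), the `G`-valuedness from
`B7Prop2Explicit.avgIter_mem`, the step from §3–§4.  With `ε = αη` this is exactly the recursion
`ε_{i+1} ≤ L·ε_i + D(L^{i+1}η)²`, `D = 128(d+1)(d+4)α₀`, whose solution on the scaling diagonal is the geometric
profile (companion 19 `profile_diagonal` ∕ `profile_geometric`). [cite: Balaban1985Averaging, (43) p.24, Prop. 2 (52)–(53) p.26] -/
theorem bond_window_tower_of_prop2 (L : ℕ) (hL : 2 ≤ L) {G : Subgroup 𝔸ˣ} (hG : AvgClosed d L G) (k : ℕ)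
    (V : B7Prop1Explicit.Site d → Fin d → 𝔸ˣ) (hV : ∀ x κ, V x κ ∈ G) {α₀ : ℝ} (hα : 0 < α₀)
    (hα3 : C0 d * α₀ ≤ 1 / 3) (hα2 : 2 * α₀ ≤ c2' d L)
    (h52 : pdev V < α₀ * (((L : ℝ) ^ k)⁻¹) ^ 2)
    {ε : ℝ} (hε : ∀ x κ, ‖((V x κ : 𝔸ˣ) : 𝔸) - 1‖ ≤ ε)
    (b : ℕ → ℝ) (hb0 : b 0 = ε)
    (hb : ∀ i, b (i + 1) = L * b i + 128 * (d + 1) * (d + 4) * α₀ * ((L : ℝ) ^ (i + 1) * ((L : ℝ) ^ k)⁻¹) ^ 2) :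
    ∀ j ≤ k + 1, ∀ (x : B7Prop1Explicit.Site d) (κ : Fin d), ‖((avgIter L V j x κ : 𝔸ˣ) : 𝔸) - 1‖ ≤ b j := by
  have hL1 : 1 ≤ L := le_trans (by norm_num) hL
  have hLr : (2 : ℝ) ≤ L := by exact_mod_cast hL
  have hL1r : (1 : ℝ) ≤ L := by linarith
  set η : ℝ := ((L : ℝ) ^ k)⁻¹ with hη
  have hη0 : 0 < η := by positivity
  have hηk : (L : ℝ) ^ k * η ≤ 1 := by rw [hη, mul_inv_cancel₀ (by positivity)]
  have hmem := avgIter_mem L hL hG k V hV hα hα3 hα2 h52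
  have hmemU : ∀ j ≤ k, ∀ x κ, avgIter L V j x κ ∈ U1 𝔸 := fun j hj x κ => hG.le_U1 (hmem j hj x κ)
  have h53 := ineq53_explicit L hL hG k V hV hα hα3 hα2 h52
  -- the bracket of (53) is `≤ 2`
  have hCα0 : 0 ≤ C0 d * α₀ := (mul_pos (C0_pos d) hα).le
  have hr0 : 0 ≤ (1 + C0 d * α₀) ^ 2 / (L : ℝ) ^ 2 := by positivity
  have hr : (1 + C0 d * α₀) ^ 2 / (L : ℝ) ^ 2 ≤ 1 / 2 := (B7.prop2_ratio_lt_half (C0 d) α₀ L hLr hCα0 hα3).le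
  -- the per-level plaquette bounds `a j = 2α₀(L^jη)²`
  set a : ℕ → ℝ := fun j => 2 * α₀ * ((L : ℝ) ^ j * η) ^ 2 with ha
  have ha0 : ∀ j ≤ k, 0 ≤ a j := fun j _ => by positivity
  have hplaq : ∀ j ≤ k, ∀ (x : B7Prop1Explicit.Site d) (κ κ' : Fin d), κ ≠ κ' →
      ‖((hol (avgIter L V j) x (plaqWord κ κ') : 𝔸ˣ) : 𝔸) - 1‖ ≤ a j := by
    intro j hj x κ κ' _
    have ht0 : 0 ≤ (L : ℝ) ^ j * η := by positivity
    have ht : (L : ℝ) ^ j * η ≤ 1 := B7.level_le_one (L : ℝ) η k hL1r hη0.le hηk j hj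
    have hS0 : 0 ≤ ∑ i ∈ Finset.range j, ((1 + C0 d * α₀) ^ 2 / (L : ℝ) ^ 2) ^ i :=
      sum_nonneg fun i _ => pow_nonneg hr0 i
    have hS := B7.geom_bracket_le_two _ hr0 hr j
    exact (le_pdev (hmemU j hj) x κ κ').trans ((h53 j hj).le.trans
      (bound53_le_two_mul (C0_pos d).le hα.le hα3 ht0 ht hS0 hS))
  have hsmall : ∀ j ≤ k, 512 * (d + 1) * (d + 4) * (L : ℝ) ^ 2 * a j ≤ 1 := by
    intro j hj
    have ht0 : 0 ≤ (L : ℝ) ^ j * η := by positivity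
    have ht : (L : ℝ) ^ j * η ≤ 1 := B7.level_le_one (L : ℝ) η k hL1r hη0.le hηk j hj
    have ht2 : ((L : ℝ) ^ j * η) ^ 2 ≤ 1 := pow_le_one₀ ht0 ht
    have haj : a j ≤ c2' d L := by
      have : 2 * α₀ * ((L : ℝ) ^ j * η) ^ 2 ≤ 2 * α₀ := mul_le_of_le_one_right (by positivity) ht2
      exact this.trans hα2
    have hK : (0 : ℝ) < 512 * (d + 1) * (d + 4) * (L : ℝ) ^ 2 := by positivity
    calc 512 * (d + 1) * (d + 4) * (L : ℝ) ^ 2 * a j ≤ 512 * (d + 1) * (d + 4) * (L : ℝ) ^ 2 * c2' d L :=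
          mul_le_mul_of_nonneg_left haj hK.le
      _ = 1 := by unfold c2'; field_simp
  have hb' : ∀ i, b (i + 1) = L * b i + 64 * (d + 1) * (d + 4) * (L : ℝ) ^ 2 * a i := by
    intro i; rw [hb i, ha]; ring
  exact bond_window_tower L hL1 V k hmemU a ha0 hsmall hplaq hε b hb0 hb'

end BondWindow

/-! # PART B — the arithmetic of the recursion `ε (i+1) ≤ L·ε i + D(L^{i+1}η)²` -/

namespace Profile

/-! ## §1 The invariant of the recursion `ε (i+1) ≤ L·ε i + D(L^{i+1}η)²` -/

/-- INVARIANT: `ε i ≤ α·(L^iη) + 2D·(L^iη)²` for all `i`, from `ε 0 ≤ αη`, the one-step recursion and `L ≥ 2`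
(the step closes because `2DL·X² + DL²X² ≤ 2DL²X²` iff `2 ≤ L`, `X = L^iη`). [folklore] -/
private theorem profile_invariant {L η α D : ℝ} (hL : 2 ≤ L) (hD : 0 ≤ D) (ε : ℕ → ℝ)
    (h0 : ε 0 ≤ α * η) (hstep : ∀ i, ε (i + 1) ≤ L * ε i + D * (L ^ (i + 1) * η) ^ 2) :
    ∀ i, ε i ≤ α * (L ^ i * η) + 2 * D * (L ^ i * η) ^ 2 := by
  have hL0 : 0 ≤ L := by linarith
  intro i
  induction i with
  | zero =>
    have hη2 : 0 ≤ 2 * D * (L ^ 0 * η) ^ 2 := by positivity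
    simpa only [pow_zero, one_mul] using le_trans h0 (by simpa only [pow_zero, one_mul] using le_add_of_nonneg_right hη2)
  | succ i ih =>
    have hX : 0 ≤ D * (L ^ i * η) ^ 2 := by positivity
    have hpow : L ^ (i + 1) * η = L * (L ^ i * η) := by ring
    have key : L * (α * (L ^ i * η) + 2 * D * (L ^ i * η) ^ 2) + D * (L ^ (i + 1) * η) ^ 2 ≤
        α * (L ^ (i + 1) * η) + 2 * D * (L ^ (i + 1) * η) ^ 2 := by
      rw [hpow]
      nlinarith [mul_nonneg hL0 (mul_nonneg hX (sub_nonneg.mpr hL))]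
    calc ε (i + 1) ≤ L * ε i + D * (L ^ (i + 1) * η) ^ 2 := hstep i
      _ ≤ L * (α * (L ^ i * η) + 2 * D * (L ^ i * η) ^ 2) + D * (L ^ (i + 1) * η) ^ 2 := by
          have := mul_le_mul_of_nonneg_left ih hL0
          linarith
      _ ≤ _ := key

/-! ## §2 On print's diagonal `ηL^{n+1} = 1`: the linear profile `ε i ≤ (α + 2D∕L)·L^iη`, `i ≤ n` -/

/-- On the diagonal, `L^iη ≤ 1∕L` for `i ≤ n`. [folklore] -/
private theorem pow_mul_eta_le {L η : ℝ} {n i : ℕ} (hL : 1 ≤ L) (hη : 0 ≤ η) (hLη : η * L ^ (n + 1) = 1) (hi : i ≤ n) :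
    L ^ i * η ≤ 1 / L := by
  have hL0 : 0 < L := by linarith
  rw [le_div_iff₀ hL0]
  calc L ^ i * η * L = L ^ (i + 1) * η := by ring
    _ ≤ L ^ (n + 1) * η := mul_le_mul_of_nonneg_right (pow_le_pow_right₀ hL (by omega)) hη
    _ = 1 := by rw [mul_comm]; exact hLη

/-- LINEAR PROFILE ON THE DIAGONAL: `ε i ≤ (α + 2D∕L)·(L^iη)` for `i ≤ n` — the quadratic (curvature) term is absorbed using `L^iη ≤ 1∕L`. [folklore] -/
private theorem profile_diagonal {L η α D : ℝ} {n : ℕ} (hL : 2 ≤ L) (hη : 0 ≤ η) (hD : 0 ≤ D)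
    (hLη : η * L ^ (n + 1) = 1) (ε : ℕ → ℝ) (h0 : ε 0 ≤ α * η)
    (hstep : ∀ i, ε (i + 1) ≤ L * ε i + D * (L ^ (i + 1) * η) ^ 2) :
    ∀ i ≤ n, ε i ≤ (α + 2 * D / L) * (L ^ i * η) := by
  intro i hi
  have hL0 : 0 < L := by linarith
  have h1 := profile_invariant hL hD ε h0 hstep i
  have h2 := pow_mul_eta_le (by linarith) hη hLη hi
  have hX0 : 0 ≤ 2 * D * (L ^ i * η) := by positivity
  have h3 : 2 * D * (L ^ i * η) ^ 2 ≤ 2 * D / L * (L ^ i * η) := by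
    calc 2 * D * (L ^ i * η) ^ 2 = 2 * D * (L ^ i * η) * (L ^ i * η) := by ring
      _ ≤ 2 * D * (L ^ i * η) * (1 / L) := mul_le_mul_of_nonneg_left h2 hX0
      _ = 2 * D / L * (L ^ i * η) := by ring
  calc ε i ≤ α * (L ^ i * η) + 2 * D * (L ^ i * η) ^ 2 := h1
    _ ≤ α * (L ^ i * η) + 2 * D / L * (L ^ i * η) := by linarith
    _ = (α + 2 * D / L) * (L ^ i * η) := by ring

/-! ## §3 In NE9's indexing (`j = 0` coarsest): `ε (n − j) ≤ ((α + 2D∕L)∕L)·(1∕L)^j` — geometric profile, ratio `r = 1∕L` -/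

/-- On the diagonal, `L^{n−j}η = 1∕L^{j+1}` for `j ≤ n`. [folklore] -/
private theorem pow_sub_mul_eta_eq {L η : ℝ} {n j : ℕ} (hL : 0 < L) (hLη : η * L ^ (n + 1) = 1) (hj : j ≤ n) :
    L ^ (n - j) * η = 1 / L ^ (j + 1) := by
  rw [eq_div_iff (pow_ne_zero _ hL.ne')]
  calc L ^ (n - j) * η * L ^ (j + 1) = η * (L ^ (n - j) * L ^ (j + 1)) := by ring
    _ = η * L ^ (n + 1) := by rw [← pow_add]; congr 2; omega
    _ = 1 := hLη

/-- GEOMETRIC PROFILE IN NE9's INDEXING: with `εU j := ε (n − j)` (the bound for `Ū^{n−j} = UlevOf L m (n+1) V j`),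
`εU j ≤ α′·r^j` with `r = 1∕L` and `α′ = (α + 2D∕L)∕L`, for `j ≤ n` — the shape of the suppliers' hypothesis `hεg : ∀ j < n + 1, εU j ≤ α′ * r ^ j`. [folklore] -/
private theorem profile_geometric {L η α D : ℝ} {n : ℕ} (hL : 2 ≤ L) (hη : 0 ≤ η) (hD : 0 ≤ D)
    (hLη : η * L ^ (n + 1) = 1) (ε : ℕ → ℝ) (h0 : ε 0 ≤ α * η)
    (hstep : ∀ i, ε (i + 1) ≤ L * ε i + D * (L ^ (i + 1) * η) ^ 2) :
    ∀ j ≤ n, ε (n - j) ≤ (α + 2 * D / L) / L * (1 / L) ^ j := by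
  intro j hj
  have hL0 : 0 < L := by linarith
  have h := profile_diagonal hL hη hD hLη ε h0 hstep (n - j) (by omega)
  rw [pow_sub_mul_eta_eq hL0 hLη hj] at h
  calc ε (n - j) ≤ (α + 2 * D / L) * (1 / L ^ (j + 1)) := h
    _ = (α + 2 * D / L) / L * (1 / L) ^ j := by rw [one_div_pow, pow_succ]; field_simp

/-- The ratio is admissible: `0 ≤ 1∕L < 1` for `L ≥ 2` (the suppliers' `hr0`, `hr1`). [folklore] -/
private theorem ratio_admissible {L : ℝ} (hL : 2 ≤ L) : 0 ≤ 1 / L ∧ 1 / L < 1 := by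
  have hL0 : 0 < L := by linarith
  exact ⟨by positivity, (div_lt_one hL0).mpr (by linarith)⟩

end Profile

/-! # PART C — the PROFILE LEMMA on the tower of tori -/

section ProfileTower

open B9Eq315QTorus (perCfg perCfg_apply)
open B9Eq315QTorusOnto (liftSite)
open B9Eq315QTower (towerP UlevOf)
open B9SectCLatticeCarrier (Bond)

variable {d : ℕ} {𝔸 : Type*} [NormedRing 𝔸] [NormedAlgebra ℂ 𝔸] [CompleteSpace 𝔸] [NormOneClass 𝔸]

/-- The bound sequence of the one-step bond recursion: `b 0 = ε`, `b (i+1) = L·b i + D·(L^{i+1}η)²`. [folklore] -/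
def bseq (L ε D η : ℝ) : ℕ → ℝ
  | 0 => ε
  | i + 1 => L * bseq L ε D η i + D * (L ^ (i + 1) * η) ^ 2

/-- `b 0 = ε`. [folklore] -/
@[simp] private theorem bseq_zero (L ε D η : ℝ) : bseq L ε D η 0 = ε := rfl

/-- `b (i+1) = L·b i + D·(L^{i+1}η)²`. [folklore] -/
private theorem bseq_succ (L ε D η : ℝ) (i : ℕ) :
    bseq L ε D η (i + 1) = L * bseq L ε D η i + D * (L ^ (i + 1) * η) ^ 2 := rfl

/-- **THE PROFILE LEMMA in NE9's currency.**  For `L ≥ 2`, a background `U` on the level-`(n+1)` torus `T_{L^{n+1}m}`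
with values in an `AvgClosed` group `G`, the fine window `‖U b − 1‖ ≤ αη` (`η = (L^{n+1})⁻¹`) and plaquette smallness
(52) for its periodic extension, `pdev (perCfg U) < α₀η²` with `C₀α₀ ≤ 1/3`, `2α₀ ≤ c₂′`: (i) every level
`UlevOf L m (n+1) U j`, `j ≤ n`, is `G`-valued, and (ii) the computed averaged tower has the GEOMETRIC PROFILE
`‖UlevOf L m (n+1) U j b − 1‖ ≤ ((α + 2D/L)/L)·(1/L)^j`, `D = 128(d+1)(d+4)α₀`, for all `j ≤ n` and all bonds `b` —
the binders `hεg : ∀ j < n + 1, εU j ≤ α′ r^j`, `hLε`, `hLb` of the diagonal suppliers with `r = 1/L`.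
Proof: PART A `bond_window_tower_of_prop2` for `V := perCfg U` (window and `G`-membership of `perCfg U` are those of
`U` pointwise, `perCfg_apply`), PART B `profile_geometric` for `bseq`, and the definitional identity
`UlevOf L m (n+1) U j b = avgIter L (perCfg U) (n + 1 − 1 − j) (liftSite b.1) b.2`. [cite: Balaban1985Averaging, Prop. 2 (52)–(53) p.26; Balaban1985BackgroundPropagators, (3.15) p.393, (3.35) p.396] -/
theorem profile_UlevOf (L : ℕ) [NeZero L] (hL : 2 ≤ L) (m : Fin d → ℕ) [∀ i, NeZero (m i)] (n : ℕ)
    (U : Bond d (towerP L m (n + 1)) → 𝔸ˣ) {G : Subgroup 𝔸ˣ} (hG : AvgClosed d L G) (hUG : ∀ b, U b ∈ G)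
    {α α₀ : ℝ} (hα₀ : 0 < α₀) (hα3 : C0 d * α₀ ≤ 1 / 3) (hα2 : 2 * α₀ ≤ c2' d L)
    (h52 : pdev (perCfg (towerP L m (n + 1)) U) < α₀ * (((L : ℝ) ^ (n + 1))⁻¹) ^ 2)
    (hwin : ∀ b, ‖((U b : 𝔸ˣ) : 𝔸) - 1‖ ≤ α * ((L : ℝ) ^ (n + 1))⁻¹) :
    (∀ j ≤ n, ∀ b, UlevOf L m (n + 1) U j b ∈ G) ∧
    (∀ j ≤ n, ∀ b, ‖((UlevOf L m (n + 1) U j b : 𝔸ˣ) : 𝔸) - 1‖ ≤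
      (α + 2 * (128 * (d + 1) * (d + 4) * α₀) / L) / L * (1 / (L : ℝ)) ^ j) := by
  set V : B7Prop1Explicit.Site d → Fin d → 𝔸ˣ := perCfg (towerP L m (n + 1)) U with hVdef
  set η : ℝ := ((L : ℝ) ^ (n + 1))⁻¹ with hη
  set D : ℝ := 128 * (d + 1) * (d + 4) * α₀ with hD
  have hLr : (2 : ℝ) ≤ L := by exact_mod_cast hL
  have hη0 : 0 ≤ η := by positivity
  have hD0 : 0 ≤ D := by positivity
  have hLη : η * (L : ℝ) ^ (n + 1) = 1 := inv_mul_cancel₀ (by positivity)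
  have hV : ∀ x κ, V x κ ∈ G := fun x κ => by rw [hVdef, perCfg_apply]; exact hUG _
  have hε : ∀ x κ, ‖((V x κ : 𝔸ˣ) : 𝔸) - 1‖ ≤ α * η := fun x κ => by rw [hVdef, perCfg_apply]; exact hwin _
  -- PART A: the bond-window tower for `V` with the bound sequence `bseq`
  have hbnd := BondWindow.bond_window_tower_of_prop2 L hL hG (n + 1) V hV hα₀ hα3 hα2 h52 hε
    (bseq L (α * η) D η) (bseq_zero _ _ _ _) (fun i => by rw [bseq_succ])
  -- PART B: the geometric profile of `bseq` on the diagonal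
  have hprof := Profile.profile_geometric (L := (L : ℝ)) hLr hη0 hD0 hLη (bseq L (α * η) D η)
    (le_of_eq (bseq_zero _ _ _ _)) (fun i => le_of_eq (bseq_succ _ _ _ _ i))
  -- the levels are `G`-valued
  have hmem := avgIter_mem L hL hG (n + 1) V hV hα₀ hα3 hα2 h52
  refine ⟨fun j hj b => ?_, fun j hj b => ?_⟩
  · show avgIter L V (n + 1 - 1 - j) (liftSite b.1) b.2 ∈ G
    exact hmem _ (by omega) _ _
  · show ‖((avgIter L V (n + 1 - 1 - j) (liftSite b.1) b.2 : 𝔸ˣ) : 𝔸) - 1‖ ≤ _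
    rw [Nat.add_sub_cancel]
    exact (hbnd (n - j) (by omega) _ _).trans (by simpa only [hD] using hprof j hj)

/-- The bound sequence is nonnegative when `L, ε, D ≥ 0`. [folklore] -/
private theorem bseq_nonneg {L ε D η : ℝ} (hL : 0 ≤ L) (hε : 0 ≤ ε) (hD : 0 ≤ D) : ∀ i, 0 ≤ bseq L ε D η i
  | 0 => hε
  | i + 1 => by
    rw [bseq_succ]
    have := bseq_nonneg (η := η) hL hε hD i
    positivity

/-- **THE PROFILE LEMMA IN THE SUPPLIERS' EXACT BINDER SHAPE.**  Under the hypotheses of `profile_UlevOf`, `0 ≤ α`, and the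
constant relation `256(d+1)(d+4)α₀ ≤ L(L−1)·α` (which makes `α′ = (α + 2D/L)/L ≤ α`), there is a profile `εU` with
`0 ≤ εU j`, `εU j ≤ α·(1/L)^j` for `j < n + 1`, `‖UlevOf L m (n+1) U j b − 1‖ ≤ εU j` and `UlevOf L m (n+1) U j b ∈ U1`
for ALL `j` (the junk levels `j > n` included: there `UlevOf … j` reads `U` itself) — literally the binders
`(∀ j, 0 ≤ εU j) → (∀ j < n + 1, εU j ≤ α * r ^ j) → (∀ j b, ‖(UlevOf L m (n + 1) U j b : 𝔸) - 1‖ ≤ εU j) →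
(∀ j b, UlevOf L m (n + 1) U j b ∈ U1 𝔸)` of `B9Thm311SitePrimeFormCoerciveTowerCanonical.exists_strong_site_coercive_tower_diagonal`
(and of the `C_Q` ∕ `κ₁` suppliers) with `r = 1/L`.  `εU j := bseq L (αη) D η (n − j)`. [cite: Balaban1985Averaging, Prop. 2 (52)–(53) p.26; Balaban1985BackgroundPropagators, (3.15) p.393, (3.35) p.396] -/
theorem profile_UlevOf_supplier (L : ℕ) [NeZero L] (hL : 2 ≤ L) (m : Fin d → ℕ) [∀ i, NeZero (m i)] (n : ℕ)
    (U : Bond d (towerP L m (n + 1)) → 𝔸ˣ) {G : Subgroup 𝔸ˣ} (hG : AvgClosed d L G) (hUG : ∀ b, U b ∈ G)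
    {α α₀ : ℝ} (hα : 0 ≤ α) (hα₀ : 0 < α₀) (hα3 : C0 d * α₀ ≤ 1 / 3) (hα2 : 2 * α₀ ≤ c2' d L)
    (h52 : pdev (perCfg (towerP L m (n + 1)) U) < α₀ * (((L : ℝ) ^ (n + 1))⁻¹) ^ 2)
    (hwin : ∀ b, ‖((U b : 𝔸ˣ) : 𝔸) - 1‖ ≤ α * ((L : ℝ) ^ (n + 1))⁻¹)
    (hDα : 2 * (128 * (d + 1) * (d + 4) * α₀) ≤ L * (L - 1) * α) :
    ∃ εU : ℕ → ℝ, (∀ j, 0 ≤ εU j) ∧ (∀ j < n + 1, εU j ≤ α * (1 / (L : ℝ)) ^ j) ∧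
      (∀ (j : ℕ) (b : Bond d (towerP L m (j + 1))), ‖((UlevOf L m (n + 1) U j b : 𝔸ˣ) : 𝔸) - 1‖ ≤ εU j) ∧
      (∀ (j : ℕ) (b : Bond d (towerP L m (j + 1))), UlevOf L m (n + 1) U j b ∈ U1 𝔸) := by
  set V : B7Prop1Explicit.Site d → Fin d → 𝔸ˣ := perCfg (towerP L m (n + 1)) U with hVdef
  set η : ℝ := ((L : ℝ) ^ (n + 1))⁻¹ with hη
  set D : ℝ := 128 * (d + 1) * (d + 4) * α₀ with hD
  have hLr : (2 : ℝ) ≤ L := by exact_mod_cast hL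
  have hL0 : (0 : ℝ) < L := by linarith
  have hη0 : 0 ≤ η := by positivity
  have hD0 : 0 ≤ D := by positivity
  have hLη : η * (L : ℝ) ^ (n + 1) = 1 := inv_mul_cancel₀ (by positivity)
  have hV : ∀ x κ, V x κ ∈ G := fun x κ => by rw [hVdef, perCfg_apply]; exact hUG _
  have hε : ∀ x κ, ‖((V x κ : 𝔸ˣ) : 𝔸) - 1‖ ≤ α * η := fun x κ => by rw [hVdef, perCfg_apply]; exact hwin _
  have hbnd := BondWindow.bond_window_tower_of_prop2 L hL hG (n + 1) V hV hα₀ hα3 hα2 h52 hε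
    (bseq L (α * η) D η) (bseq_zero _ _ _ _) (fun i => by rw [bseq_succ])
  have hprof := Profile.profile_geometric (L := (L : ℝ)) hLr hη0 hD0 hLη (bseq L (α * η) D η)
    (le_of_eq (bseq_zero _ _ _ _)) (fun i => le_of_eq (bseq_succ _ _ _ _ i))
  have hmem := avgIter_mem L hL hG (n + 1) V hV hα₀ hα3 hα2 h52
  -- the constant relation: `α′ ≤ α`
  have hα' : (α + 2 * D / L) / L ≤ α := by
    rw [div_le_iff₀ hL0]
    have h2 : 2 * D / L ≤ (L - 1) * α := by
      rw [div_le_iff₀ hL0]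
      nlinarith [hDα]
    nlinarith [h2]
  refine ⟨fun j => bseq L (α * η) D η (n - j), fun j => bseq_nonneg hL0.le (by positivity) hD0 _,
    fun j hj => ?_, fun j b => ?_, fun j b => ?_⟩
  · exact (hprof j (by omega)).trans (mul_le_mul_of_nonneg_right hα' (by positivity))
  · show ‖((avgIter L V (n + 1 - 1 - j) (liftSite b.1) b.2 : 𝔸ˣ) : 𝔸) - 1‖ ≤ _
    rw [Nat.add_sub_cancel]
    exact hbnd (n - j) (by omega) _ _
  · show avgIter L V (n + 1 - 1 - j) (liftSite b.1) b.2 ∈ U1 𝔸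
    exact hG.le_U1 (hmem _ (by omega) _ _)

end ProfileTower

end Literature.MathematicalPhysics.QuantumFieldTheory.Balaban1983to89.B9Eq315ProfileTower
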